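import Mathlib
import HarnessLib
import Summits.ResolutionOfSingularities.ResolutionOfSingularities.Theorems.WildQuotientsWildQuotientResolutionS1aPrincipalCentre

/-!
# S1a — GLUING CENTRES BY INTERSECTION: the (K2)/(A2-glue) formal lemma (STRATEGY-DESIGN v3.4 §typing, ASSIGNMENT v10.10 F5)

[OURS · L1 W4.5c · lead-1 g8] — NOT statements of the manuscript; counted 0; AI-level work, weaker than expert review. Crux stmt-ResolutionOfSingularities-17941,
line `s1a-logminvertex` v6. Route-independent.

ONE lemma for both uses: finitely many GLOBAL `G`-stable Rees filtrations `𝒦ᵢ` on `V` such that every point has a node chart `O` on which all the `𝒦ᵢ` that are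
non-trivial COINCIDE (and make `O` a (principal-)centre chart) glue to the admissible (principal) centre `⨅ᵢ 𝒦ᵢ` with the same charts. (K2) = equal germs on
overlaps; (A2-glue) = pairwise disjoint supports (then at most one `𝒦ᵢ` is non-trivial on a small chart) — both are instances.
* `infRees 𝒦` — the intersection `n ↦ ⨅ᵢ 𝒦ᵢ(n)` of finitely many Rees filtrations (multiplicative by `Ideal.mul_mono` sectionwise);
* `filtration_infRees_eq` — on an affine open where every `𝒦ⱼ` is trivial or equal to `𝒦_{i₀}`, the intersection equals `𝒦_{i₀}`;
* `comapOrderIso` — `comap` along an isomorphism is an order isomorphism of ideal sheaves, so `G`-stability passes to `⨅` (`comap_aut_infRees`);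
* `isCentreChart_congr` / `isPrincipalCentreChart_congr` / `isIdleChart_of_forall_eq_top` — chart predicates only see the filtration through its values on the chart;
* **`isAdmissibleCentre_infRees`**, **`isPrincipalCentre_infRees`** — the gluing theorems.
-/

set_option linter.dupNamespace false

noncomputable section

open CategoryTheory AlgebraicGeometry TopologicalSpace
open Literature.AlgebraicGeometry.Resolution Literature.AlgebraicGeometry.RelativeSpec
open Summit.ResolutionOfSingularities.ResolutionOfSingularities.Theorems.WildQuotientResolution.S1
open Summit.ResolutionOfSingularities.ResolutionOfSingularities.Theorems.WildQuotientResolution.S1.NodeAtlas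

namespace Summit.ResolutionOfSingularities.ResolutionOfSingularities.Theorems.WildQuotientResolution.S1.CentreGluing

universe u

/-! ## Intersections of Rees filtrations -/

section Inf

variable {V : Scheme.{u}} {ι : Type} [Finite ι]

/-- **The intersection of finitely many Rees filtrations.** [OURS · L1 W4.5c] -/
def infRees (𝒦 : ι → ReesFiltration V) : ReesFiltration V where
  ideal n := ⨅ i, (𝒦 i).ideal n
  ideal_zero := by
    have : (fun i => (𝒦 i).ideal 0) = fun _ => ⊤ := funext fun i => (𝒦 i).ideal_zero
    rw [this, iInf_top]
  antitone m n h := iInf_mono fun i => (𝒦 i).antitone h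
  mul_le m n := by
    rw [Scheme.IdealSheafData.le_def]
    intro U
    rw [Scheme.IdealSheafData.ideal_mul, Pi.mul_apply, Scheme.IdealSheafData.ideal_iInf, Scheme.IdealSheafData.ideal_iInf,
      Scheme.IdealSheafData.ideal_iInf, iInf_apply, iInf_apply, iInf_apply]
    refine le_iInf fun i => ?_
    have h := (𝒦 i).mul_le m n
    rw [Scheme.IdealSheafData.le_def] at h
    have hU := h U
    rw [Scheme.IdealSheafData.ideal_mul, Pi.mul_apply] at hU
    exact (Ideal.mul_mono (iInf_le (fun j => ((𝒦 j).ideal m).ideal U) i) (iInf_le (fun j => ((𝒦 j).ideal n).ideal U) i)).trans hU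

/-- Pieces of the intersection. -/
@[simp] theorem infRees_ideal (𝒦 : ι → ReesFiltration V) (n : ℕ) : (infRees 𝒦).ideal n = ⨅ i, (𝒦 i).ideal n := rfl

/-- Sections of the intersection over an affine open. -/
theorem filtration_infRees (𝒦 : ι → ReesFiltration V) (U : V.affineOpens) (n : ℕ) :
    ((infRees 𝒦).filtration U).ideal n = ⨅ i, ((𝒦 i).filtration U).ideal n := by
  rw [ReesFiltration.filtration_ideal, infRees_ideal, Scheme.IdealSheafData.ideal_iInf, iInf_apply]
  rfl

/-- **On an affine open where every `𝒦ⱼ` is trivial or equal to `𝒦_{i₀}`, the intersection IS `𝒦_{i₀}`.** [OURS · L1 W4.5c] -/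
theorem filtration_infRees_eq (𝒦 : ι → ReesFiltration V) (U : V.affineOpens) (i₀ : ι)
    (h : ∀ j, (∀ n, ((𝒦 j).filtration U).ideal n = ⊤) ∨ ∀ n, ((𝒦 j).filtration U).ideal n = ((𝒦 i₀).filtration U).ideal n) (n : ℕ) :
    ((infRees 𝒦).filtration U).ideal n = ((𝒦 i₀).filtration U).ideal n := by
  rw [filtration_infRees]
  apply le_antisymm (iInf_le _ i₀)
  refine le_iInf fun j => ?_
  rcases h j with hj | hj
  · rw [hj n]; exact le_top
  · rw [hj n]

/-- On an affine open where every `𝒦ⱼ` is trivial, so is the intersection. -/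
theorem filtration_infRees_eq_top (𝒦 : ι → ReesFiltration V) (U : V.affineOpens) (h : ∀ j n, ((𝒦 j).filtration U).ideal n = ⊤) (n : ℕ) :
    ((infRees 𝒦).filtration U).ideal n = ⊤ := by
  rw [filtration_infRees, eq_top_iff]
  exact le_iInf fun j => (h j n).ge

end Inf

/-! ## `comap` along an isomorphism preserves intersections -/

section Comap

variable {X Y : Scheme.{u}}

/-- **`comap` along an isomorphism of schemes is an order isomorphism of ideal sheaves.** [OURS · L1 W4.5c] -/
def comapOrderIso (e : X ≅ Y) : Y.IdealSheafData ≃o X.IdealSheafData where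
  toFun I := I.comap e.hom
  invFun J := J.comap e.inv
  left_inv I := by
    change (I.comap e.hom).comap e.inv = I
    rw [← Scheme.IdealSheafData.comap_comp, Iso.inv_hom_id, Scheme.IdealSheafData.comap_id]
  right_inv J := by
    change (J.comap e.inv).comap e.hom = J
    rw [← Scheme.IdealSheafData.comap_comp, Iso.hom_inv_id, Scheme.IdealSheafData.comap_id]
  map_rel_iff' := by
    intro I J
    constructor
    · intro h
      have h' := Scheme.IdealSheafData.comap_mono e.inv h
      change (I.comap e.hom).comap e.inv ≤ (J.comap e.hom).comap e.inv at h'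
      rwa [← Scheme.IdealSheafData.comap_comp, ← Scheme.IdealSheafData.comap_comp, Iso.inv_hom_id, Scheme.IdealSheafData.comap_id,
        Scheme.IdealSheafData.comap_id] at h'
    · exact fun h => Scheme.IdealSheafData.comap_mono e.hom h

/-- `comap` along an isomorphism commutes with finite (indeed arbitrary) intersections. -/
theorem comap_iInf_of_iso {ι : Sort*} (e : X ≅ Y) (I : ι → Y.IdealSheafData) : (⨅ i, I i).comap e.hom = ⨅ i, (I i).comap e.hom :=
  (comapOrderIso e).map_iInf I

variable {V Y' : Scheme.{u}} {q : V ⟶ Y'} {G : Type*} [Group G] (ρ : ActionOver q G) {ι : Type} [Finite ι]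

/-- **`G`-stability passes to the intersection.** [OURS · L1 W4.5c] -/
theorem comap_aut_infRees (𝒦 : ι → ReesFiltration V) (h : ∀ (i : ι) (g : G) (n : ℕ), ((𝒦 i).ideal n).comap (ρ.aut g).hom = (𝒦 i).ideal n) (g : G)
    (n : ℕ) : ((infRees 𝒦).ideal n).comap (ρ.aut g).hom = (infRees 𝒦).ideal n := by
  rw [infRees_ideal, comap_iInf_of_iso (ρ.aut g)]
  exact iInf_congr fun i => h i g n

end Comap

/-! ## Chart predicates only see the filtration on the chart -/

section Congr

variable {p : ℕ} {V Y : Scheme.{u}} {q : V ⟶ Y} {G : Type*} [Group G] {ρ : ActionOver q G} {g₀ : G}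

/-- `IsCentreChart` transfers along equality of the filtrations on the chart. -/
theorem isCentreChart_congr {𝒦₁ 𝒦₂ : ReesFiltration V} {d : ℕ} {O : ρ.StableAffineOpens} (h₁ : IsCentreChart p ρ g₀ 𝒦₁ d O)
    (heq : ∀ (hO : IsAffineOpen O.1) (n : ℕ), (𝒦₂.filtration ⟨O.1, hO⟩).ideal n = (𝒦₁.filtration ⟨O.1, hO⟩).ideal n) :
    IsCentreChart p ρ g₀ 𝒦₂ d O := by
  obtain ⟨hO, m, r, B, _, 𝒜, _, σ, e, hnode, hσ, c, f, δ, w, hc, hf, hw, hK1, hK1', hσJ, h𝒦, hver⟩ := h₁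
  exact ⟨hO, m, r, B, inferInstance, 𝒜, inferInstance, σ, e, hnode, hσ, c, f, δ, w, hc, hf, hw, hK1, hK1', hσJ,
    fun n => (heq hO n).trans (h𝒦 n), hver⟩

/-- `IsPrincipalCentreChart` transfers along equality of the filtrations on the chart. -/
theorem isPrincipalCentreChart_congr {𝒦₁ 𝒦₂ : ReesFiltration V} {d : ℕ} {O : ρ.StableAffineOpens} (h₁ : IsPrincipalCentreChart p ρ g₀ 𝒦₁ d O)
    (heq : ∀ (hO : IsAffineOpen O.1) (n : ℕ), (𝒦₂.filtration ⟨O.1, hO⟩).ideal n = (𝒦₁.filtration ⟨O.1, hO⟩).ideal n) :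
    IsPrincipalCentreChart p ρ g₀ 𝒦₂ d O := by
  obtain ⟨hO, m, r, B, _, 𝒜, _, σ, e, hnode, hσ, c, f, δ, w, hc, hf, hw, hK1, hK1', hσJ, h𝒦, hver, hprin⟩ := h₁
  exact ⟨hO, m, r, B, inferInstance, 𝒜, inferInstance, σ, e, hnode, hσ, c, f, δ, w, hc, hf, hw, hK1, hK1', hσJ,
    fun n => (heq hO n).trans (h𝒦 n), hver, hprin⟩

/-- `IsIdleChart` from triviality of the filtration on a node chart. -/
theorem isIdleChart_of_forall_eq_top {𝒦 : ReesFiltration V} {O : ρ.StableAffineOpens} (hnode : IsNodeChart p ρ g₀ O)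
    (h : ∀ n : ℕ, (𝒦.filtration ⟨O.1, hnode.1⟩).ideal n = ⊤) : IsIdleChart p ρ g₀ 𝒦 O :=
  ⟨hnode, h⟩

end Congr

/-! ## The gluing theorems -/

section Glue

variable {p : ℕ} {V Y : Scheme.{u}} {q : V ⟶ Y} {G : Type*} [Group G] (ρ : ActionOver q G) (g₀ : G) {ι : Type} [Finite ι]

/-- **GLUING BY INTERSECTION — admissible centres.** Let `𝒦ᵢ` be finitely many `G`-stable Rees filtrations and `0 < d`. If every point of `V` has a
`G`-stable open `O` which is EITHER a centre chart of some `𝒦_{i₀}` on which every `𝒦ⱼ` is trivial or coincides with `𝒦_{i₀}`, OR a node chart on which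
every `𝒦ⱼ` is trivial, then `⨅ᵢ 𝒦ᵢ` is an ADMISSIBLE CENTRE with these charts. [OURS · L1 W4.5c] -/
theorem isAdmissibleCentre_infRees (𝒦 : ι → ReesFiltration V) {d : ℕ} (hd : 0 < d)
    (hG : ∀ (i : ι) (g : G) (n : ℕ), ((𝒦 i).ideal n).comap (ρ.aut g).hom = (𝒦 i).ideal n)
    (hcov : ∀ v : V, ∃ O : ρ.StableAffineOpens, v ∈ O.1 ∧
      ((∃ i₀, IsCentreChart p ρ g₀ (𝒦 i₀) d O ∧ ∀ (hO : IsAffineOpen O.1) (j : ι),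
          (∀ n, ((𝒦 j).filtration ⟨O.1, hO⟩).ideal n = ⊤) ∨ ∀ n, ((𝒦 j).filtration ⟨O.1, hO⟩).ideal n = ((𝒦 i₀).filtration ⟨O.1, hO⟩).ideal n) ∨
        (∃ hn : IsNodeChart p ρ g₀ O, ∀ (j : ι) (n : ℕ), ((𝒦 j).filtration ⟨O.1, hn.1⟩).ideal n = ⊤))) :
    IsAdmissibleCentre p ρ g₀ (infRees 𝒦) d := by
  refine ⟨hd, comap_aut_infRees ρ 𝒦 hG, fun v => ?_⟩
  obtain ⟨O, hv, hO⟩ := hcov v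
  rcases hO with ⟨i₀, hc, hj⟩ | ⟨hn, hj⟩
  · exact ⟨O, hv, Or.inl (isCentreChart_congr hc fun hO n => filtration_infRees_eq 𝒦 ⟨O.1, hO⟩ i₀ (hj hO) n)⟩
  · exact ⟨O, hv, Or.inr (isIdleChart_of_forall_eq_top hn fun n => filtration_infRees_eq_top 𝒦 ⟨O.1, hn.1⟩ hj n)⟩

/-- **GLUING BY INTERSECTION — principal centres** (the form (K2) needs: local principal kills that coincide where their charts overlap, and (A2-glue): local
centres with pairwise disjoint supports). [OURS · L1 W4.5c] -/
theorem isPrincipalCentre_infRees (𝒦 : ι → ReesFiltration V) {d : ℕ} (hd : 0 < d)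
    (hG : ∀ (i : ι) (g : G) (n : ℕ), ((𝒦 i).ideal n).comap (ρ.aut g).hom = (𝒦 i).ideal n)
    (hcov : ∀ v : V, ∃ O : ρ.StableAffineOpens, v ∈ O.1 ∧
      ((∃ i₀, IsPrincipalCentreChart p ρ g₀ (𝒦 i₀) d O ∧ ∀ (hO : IsAffineOpen O.1) (j : ι),
          (∀ n, ((𝒦 j).filtration ⟨O.1, hO⟩).ideal n = ⊤) ∨ ∀ n, ((𝒦 j).filtration ⟨O.1, hO⟩).ideal n = ((𝒦 i₀).filtration ⟨O.1, hO⟩).ideal n) ∨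
        (∃ hn : IsNodeChart p ρ g₀ O, ∀ (j : ι) (n : ℕ), ((𝒦 j).filtration ⟨O.1, hn.1⟩).ideal n = ⊤))) :
    IsPrincipalCentre p ρ g₀ (infRees 𝒦) d := by
  refine ⟨hd, comap_aut_infRees ρ 𝒦 hG, fun v => ?_⟩
  obtain ⟨O, hv, hO⟩ := hcov v
  rcases hO with ⟨i₀, hc, hj⟩ | ⟨hn, hj⟩
  · exact ⟨O, hv, Or.inl (isPrincipalCentreChart_congr hc fun hO n => filtration_infRees_eq 𝒦 ⟨O.1, hO⟩ i₀ (hj hO) n)⟩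
  · exact ⟨O, hv, Or.inr (isIdleChart_of_forall_eq_top hn fun n => filtration_infRees_eq_top 𝒦 ⟨O.1, hn.1⟩ hj n)⟩

/-- A principal-centre chart of `𝒦_{i₀}` on which the other `𝒦ⱼ` are trivial or equal is a principal-centre chart of the intersection (pointwise form,
for `KillableAt`-style bookkeeping). -/
theorem isPrincipalCentreChart_infRees (𝒦 : ι → ReesFiltration V) {d : ℕ} {O : ρ.StableAffineOpens} (i₀ : ι)
    (hc : IsPrincipalCentreChart p ρ g₀ (𝒦 i₀) d O)
    (hj : ∀ (hO : IsAffineOpen O.1) (j : ι),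
      (∀ n, ((𝒦 j).filtration ⟨O.1, hO⟩).ideal n = ⊤) ∨ ∀ n, ((𝒦 j).filtration ⟨O.1, hO⟩).ideal n = ((𝒦 i₀).filtration ⟨O.1, hO⟩).ideal n) :
    IsPrincipalCentreChart p ρ g₀ (infRees 𝒦) d O :=
  isPrincipalCentreChart_congr hc fun hO n => filtration_infRees_eq 𝒦 ⟨O.1, hO⟩ i₀ (hj hO) n

end Glue

end Summit.ResolutionOfSingularities.ResolutionOfSingularities.Theorems.WildQuotientResolution.S1.CentreGluing

end
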